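import Summits.AtomisticToContinuum.BoseEinsteinCondensation.Theorems.BECInfDivCoherenceGridInfDivCoherenceCoherencePosFreeRegion
import Literature.Barriers.AtomisticToContinuum.KineticGapLengthScalesThermodynamicWindow
import HarnessLib

/-!
# Crux `GridInfDivCoherence` (stmt-AtomisticToContinuum-9114), line `registered`: the soft reduction of the sign
# conjunct to the `L²` ground states (registered stub `stub_gridLevySign_of_groundStates`)

The sign conjunct of the crux asks, dilute and eventually in `N`, for every `ε > 0` a slack `δ > 0` such that every
`δ`-near-minimiser `Ψ` of the periodic `N`-body energy on the torus of side `L = (N/ρ)^{1/3}` has all non-trivial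
discrete Lévy weights `ν̃_q = m⁻³ Σ_j log G_Ψ(i,(L/m)j) cos(2π q·j/m) ≥ −ε`, where
`G_Ψ(i,r) = re ∫_{cell^N} conj Ψ(…,xᵢ+r,…) Ψ(X) dX` and `m = ⌊L/η⌋`. Because `δ` is chosen after `N` and `ε`, this
is a statement about the unit vectors of the maximal-form ground-state class at fixed `N`; this file proves the
reduction: IF every unit ground state `f` has positive translation coherence `re⟪τ_{i,u} f, f⟫ > 0` at every
single-particle torus shift, AND every such `f` has `ν̃_q(G_f) ≥ 0` exactly, THEN the sign conjunct holds.

Proof (namespace `GridLevySignReduction`): at a large `N` (with `E₀ < ⊤` by Ruelle finiteness,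
`exists_eventually_periodicGroundStateEnergy_lt_top`) it suffices, `Fin N` and the grid being finite, to find a
slack for one particle `i` and one frequency `q` (`exists_slack_one`); if none exists, `1/(k+1)`-near-minimisers
`Ψ_k` violate the bound, a subsequence of their free-embedded classes `ι₀Ψ_k` converges in `L²((ℝ/ℤ)^{3N})` to a unit
ground state `f` (`CoherencePosHC.exists_groundState_limit`), the cell coherences
`G_{Ψ_k}(i,r) = re⟪τ ι₀Ψ_k, ι₀Ψ_k⟫` (`re_cellCoherence_eq`, from `CoherencePosL2.inner_translate_formEmbed_trialState`)
converge to `G_f(i,r) > 0` at the finitely many grid nodes (continuity of the amplitude, `tendsto_re_inner_map`),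
so do their logarithms, and the weights converge to `ν̃_q(G_f) ≥ 0` (`tendsto_logWeight`) — contradiction.
References: Reed–Simon IV Thm XIII.64 [ReedSimonIV1978]; Mora–Castin 2003 §4.3 [MoraCastin2003].
-/

noncomputable section

namespace Summit.AtomisticToContinuum.BoseEinsteinCondensation.Theorems

open MeasureTheory Filter Literature.MathematicalPhysics.QuantumManyBody Literature.MathematicalPhysics.QuantumManyBody.BoseGas
  Literature.Analysis.FunctionSpaces
open scoped ENNReal NNReal ComplexConjugate InnerProductSpace Topology

attribute [local instance] formDomain_measureSpace formDomain_isProbabilityMeasure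
  formDomain_isProbabilityMeasure_pi comparison_isAddHaarMeasure comparison_isAddRightInvariant

namespace GridLevySignReduction

open Summit.AtomisticToContinuum.BoseEinsteinCondensation.Cruxes.StaticResponseBound.UvThomsonForceWave

variable {N : ℕ} {L : ℝ} {v : ℝ → ℝ≥0∞}

/-- Local notation for the Hilbert space `L²((ℝ/ℤ)^{3N})`. -/
local notation "L2T " N':max => Lp ℂ 2 (volume : Measure (UnitAddTorus (Fin N' × Fin 3)))

/-- Local notation: the translation `(τ_s g)(t) = g(t + s)` on `L²((ℝ/ℤ)^{3N})` (a linear isometry). -/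
local notation "τ[" s "]" =>
  Lp.compMeasurePreservingₗᵢ ℂ (fun t => t + s) (measurePreserving_add_right volume s)

set_option quotPrecheck false in
/-- Local notation: the FREE embedding `ι₀Ψ ∈ L²((ℝ/ℤ)^{3N})` of a periodic trial state (auxiliary profile `0`). -/
local notation "ι₀[" hL "," Ψ "]" =>
  formEmbed hL measurable_zeroProfile (lintegral_periodicInteraction_zero_ne_top _ _)
    ⟨graphEmbed hL measurable_zeroProfile (lintegral_periodicInteraction_zero_ne_top _ _)
      ⟨PeriodicTrialState.ψ Ψ, PeriodicTrialState.mem_periodicCore Ψ⟩, graphEmbed_mem_formDomain _ _ _ _⟩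

/-! ### Three soft facts: continuity of an amplitude, of the log-weights, and the dictionary -/

/-- **Continuity of a transition amplitude along a convergent sequence**: for a linear isometry `U` of a complex
inner product space and `a_n → b`, `re⟪U a_n, a_n⟫ → re⟪U b, b⟫`. [folklore] -/
theorem tendsto_re_inner_map {E : Type*} [NormedAddCommGroup E] [InnerProductSpace ℂ E]
    (U : E →ₗᵢ[ℂ] E) {a : ℕ → E} {b : E} (h : Tendsto a atTop (𝓝 b)) :
    Tendsto (fun n => (⟪U (a n), a n⟫_ℂ).re) atTop (𝓝 (⟪U b, b⟫_ℂ).re) :=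
  ((Complex.continuous_re.comp (U.continuous.inner continuous_id')).tendsto b).comp h

/-- **Continuity of the log-weights**: if `a_n(j) → b(j) > 0` at every node `j` of a finite set `s`, then
`(Σ_{j ∈ s} log a_n(j) c_j) / d → (Σ_{j ∈ s} log b(j) c_j) / d` (continuity of `Real.log` away from `0`, finite sums).
[folklore] -/
theorem tendsto_logWeight {ι : Type*} (s : Finset ι) {a : ℕ → ι → ℝ} {b : ι → ℝ} (c : ι → ℝ) (d : ℝ)
    (hb : ∀ j, 0 < b j) (h : ∀ j, Tendsto (fun n => a n j) atTop (𝓝 (b j))) :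
    Tendsto (fun n => (∑ j ∈ s, Real.log (a n j) * c j) / d) atTop
      (𝓝 ((∑ j ∈ s, Real.log (b j) * c j) / d)) :=
  (tendsto_finsetSum s fun j _ =>
    (((Real.continuousAt_log (hb j).ne').tendsto).comp (h j)).mul_const (c j)).div_const d

/-- **The dictionary**: the cell coherence of a periodic trial state at particle `i` and shift `r` is the torus
amplitude `re⟪τ_{i, r/L} ι₀Ψ, ι₀Ψ⟫` of its free-embedded class at the single-particle torus shift
(`CoherencePosL2.inner_translate_formEmbed_trialState`, `update_eq_add_single`, `CoherencePosHC.toUnitTorusN_single`).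
[folklore] -/
theorem re_cellCoherence_eq (hL : 0 < L) (Ψ : PeriodicTrialState N L) (i : Fin N) (r : Space) :
    (∫ X in cellN N L, conj (Ψ.ψ (Function.update X i (X i + r))) * Ψ.ψ X).re =
      (⟪(τ[fun p : Fin N × Fin 3 => (Pi.single i (toUnitTorus L r) : Fin N → UnitAddTorus (Fin 3)) p.1 p.2]
        (ι₀[hL, Ψ]) : L2T N), ι₀[hL, Ψ]⟫_ℂ).re := by
  have hdict := CoherencePosL2.inner_translate_formEmbed_trialState hL measurable_zeroProfile
    (lintegral_periodicInteraction_zero_ne_top N L) Ψ (Pi.single i r : Config N)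
  simp_rw [update_eq_add_single]
  rw [← hdict, CoherencePosHC.toUnitTorusN_single L i r]

/-- **Convergence of the node coherences**: if the free-embedded classes `ι₀Ψ_n` converge in `L²((ℝ/ℤ)^{3N})` to
`f`, the cell coherences `G_{Ψ_n}(i,r)` converge to `re⟪τ_{i, r/L} f, f⟫` (the dictionary and continuity of the
amplitude). [folklore] -/
theorem tendsto_re_cellCoherence (hL : 0 < L) (Ψ : ℕ → PeriodicTrialState N L) (f : L2T N)
    (hconv : Tendsto (fun j => (ι₀[hL, Ψ j] : L2T N)) atTop (𝓝 f)) (i : Fin N) (r : EuclideanSpace ℝ (Fin 3)) :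
    Tendsto (fun n => (∫ X in cellN N L,
      conj ((Ψ n).ψ (Function.update X i (X i + r))) * (Ψ n).ψ X).re) atTop
      (𝓝 ((⟪(τ[fun p : Fin N × Fin 3 =>
        (Pi.single i (toUnitTorus L r) : Fin N → UnitAddTorus (Fin 3)) p.1 p.2] f : L2T N), f⟫_ℂ).re)) := by
  have h1 := tendsto_re_inner_map (E := L2T N) (τ[fun p : Fin N × Fin 3 =>
      (Pi.single i (toUnitTorus L r) : Fin N → UnitAddTorus (Fin 3)) p.1 p.2]) hconv
  refine h1.congr fun n => ?_
  exact (re_cellCoherence_eq hL (Ψ n) i r).symm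

/-! ### The slack for one particle and one frequency, then for all -/

/-- **The slack for one particle `i` and one frequency `q`** (fixed box, `E₀ < ⊤`). If every unit maximal-form
ground state has positive translation coherence at every single-particle torus shift, and every such state has
non-negative non-trivial grid Lévy weights, then for every `ε > 0` some `δ > 0` makes the `q`-th grid Lévy weight
of the cell coherence of every `δ`-near-minimiser `≥ −ε` (for non-trivial `q`). By contradiction:
`1/(k+1)`-near-minimisers violating the bound have a subsequence whose free-embedded classes converge to a unit
ground state; the node coherences, their logarithms and the weights converge. [cite: ReedSimonIV1978, Thm XIII.64] -/
theorem exists_slack_one (hv : IsRepulsiveFiniteRange v) (hL : 0 < L)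
    (hE : periodicGroundStateEnergy v N L ≠ ⊤) (m : ℕ) {ε : ℝ} (hε : 0 < ε)
    (hP : ∀ f : L2T N, f ∈ maxFormGroundStates v N L → ‖f‖ = 1 →
      ∀ (i : Fin N) (u : UnitAddTorus (Fin 3)),
        0 < (⟪(τ[fun p : Fin N × Fin 3 => (Pi.single i u : Fin N → UnitAddTorus (Fin 3)) p.1 p.2] f : L2T N),
          f⟫_ℂ).re)
    (hS : ∀ f : L2T N, f ∈ maxFormGroundStates v N L → ‖f‖ = 1 → ∀ i : Fin N,
      (∀ r : EuclideanSpace ℝ (Fin 3), 0 < (⟪(τ[fun p : Fin N × Fin 3 =>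
          (Pi.single i (toUnitTorus L r) : Fin N → UnitAddTorus (Fin 3)) p.1 p.2] f : L2T N), f⟫_ℂ).re) →
      ∀ q : Fin 3 → Fin m, (∃ k, (q k : ℕ) ≠ 0) →
        0 ≤ (∑ j : Fin 3 → Fin m,
          Real.log ((⟪(τ[fun p : Fin N × Fin 3 =>
            (Pi.single i (toUnitTorus L (latticeVec (L / m) (fun k => ((j k : ℕ) : ℤ)))) :
              Fin N → UnitAddTorus (Fin 3)) p.1 p.2] f : L2T N), f⟫_ℂ).re) *
            Real.cos (2 * Real.pi * (∑ k, ((q k : ℕ) : ℝ) * ((j k : ℕ) : ℝ)) / m)) / (m : ℝ) ^ 3)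
    (i : Fin N) (q : Fin 3 → Fin m) :
    ∃ δ : ℝ≥0∞, 0 < δ ∧ ∀ Ψ : PeriodicTrialState N L,
      periodicEnergy v Ψ ≤ periodicGroundStateEnergy v N L + δ → (∃ k, (q k : ℕ) ≠ 0) →
        -ε ≤ (∑ j : Fin 3 → Fin m,
          Real.log ((∫ X in cellN N L, conj (Ψ.ψ (Function.update X i
            (X i + latticeVec (L / m) (fun k => ((j k : ℕ) : ℤ))))) * Ψ.ψ X).re) *
            Real.cos (2 * Real.pi * (∑ k, ((q k : ℕ) : ℝ) * ((j k : ℕ) : ℝ)) / m)) / (m : ℝ) ^ 3 := by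
  by_cases hq : ∃ k, (q k : ℕ) ≠ 0
  swap
  · exact ⟨1, one_pos, fun _ _ h => (hq h).elim⟩
  by_contra hcon
  push Not at hcon
  choose Ψ hΨE _hΨq hΨlt using fun k : ℕ =>
    hcon (ENNReal.ofReal (1 / ((k : ℝ) + 1))) (ENNReal.ofReal_pos.2 Nat.one_div_pos_of_nat)
  obtain ⟨f, hf, hf1, φ, -, hconv⟩ := CoherencePosHC.exists_groundState_limit hv hL hE Ψ hΨE
  -- the coherence of the limit ground state is positive, so its weight is non-negative
  have hGpos : ∀ r : EuclideanSpace ℝ (Fin 3), 0 < (⟪(τ[fun p : Fin N × Fin 3 =>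
      (Pi.single i (toUnitTorus L r) : Fin N → UnitAddTorus (Fin 3)) p.1 p.2] f : L2T N), f⟫_ℂ).re :=
    fun r => hP f hf hf1 i (toUnitTorus L r)
  have hlim := hS f hf hf1 i hGpos q hq
  -- the node coherences of the subsequence converge to those of `f`, hence so do the weights
  have hnode := tendsto_re_cellCoherence hL (fun n => Ψ (φ n)) f hconv i
  have hw := tendsto_logWeight (Finset.univ : Finset (Fin 3 → Fin m))
    (a := fun n j => (∫ X in cellN N L, conj ((Ψ (φ n)).ψ (Function.update X i
      (X i + latticeVec (L / m) (fun k => ((j k : ℕ) : ℤ))))) * (Ψ (φ n)).ψ X).re)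
    (b := fun j => (⟪(τ[fun p : Fin N × Fin 3 =>
      (Pi.single i (toUnitTorus L (latticeVec (L / m) (fun k => ((j k : ℕ) : ℤ)))) :
        Fin N → UnitAddTorus (Fin 3)) p.1 p.2] f : L2T N), f⟫_ℂ).re)
    (fun j => Real.cos (2 * Real.pi * (∑ k, ((q k : ℕ) : ℝ) * ((j k : ℕ) : ℝ)) / m)) ((m : ℝ) ^ 3)
    (fun j => hGpos _) (fun j => hnode _)
  -- the bound `> -ε` holds eventually along the subsequence: contradiction
  have hlt : -ε < (∑ j : Fin 3 → Fin m, Real.log ((⟪(τ[fun p : Fin N × Fin 3 =>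
      (Pi.single i (toUnitTorus L (latticeVec (L / m) (fun k => ((j k : ℕ) : ℤ)))) :
        Fin N → UnitAddTorus (Fin 3)) p.1 p.2] f : L2T N), f⟫_ℂ).re) *
      Real.cos (2 * Real.pi * (∑ k, ((q k : ℕ) : ℝ) * ((j k : ℕ) : ℝ)) / m)) / (m : ℝ) ^ 3 := by
    linarith
  obtain ⟨n, hn⟩ := (hw.eventually_const_lt hlt).exists
  exact (not_le.2 (hΨlt (φ n))) hn.le

/-- **The slack for all particles and frequencies** (fixed box, `E₀ < ⊤`): the minimum over the finite index set
`Fin N × (Fin 3 → Fin m)` of the slacks of `exists_slack_one` (a `δ`-near-minimiser is a `δ'`-near-minimiser for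
`δ ≤ δ'`). [folklore] -/
theorem exists_slack_all (hv : IsRepulsiveFiniteRange v) (hL : 0 < L)
    (hE : periodicGroundStateEnergy v N L ≠ ⊤) (m : ℕ) {ε : ℝ} (hε : 0 < ε)
    (hP : ∀ f : L2T N, f ∈ maxFormGroundStates v N L → ‖f‖ = 1 →
      ∀ (i : Fin N) (u : UnitAddTorus (Fin 3)),
        0 < (⟪(τ[fun p : Fin N × Fin 3 => (Pi.single i u : Fin N → UnitAddTorus (Fin 3)) p.1 p.2] f : L2T N),
          f⟫_ℂ).re)
    (hS : ∀ f : L2T N, f ∈ maxFormGroundStates v N L → ‖f‖ = 1 → ∀ i : Fin N,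
      (∀ r : EuclideanSpace ℝ (Fin 3), 0 < (⟪(τ[fun p : Fin N × Fin 3 =>
          (Pi.single i (toUnitTorus L r) : Fin N → UnitAddTorus (Fin 3)) p.1 p.2] f : L2T N), f⟫_ℂ).re) →
      ∀ q : Fin 3 → Fin m, (∃ k, (q k : ℕ) ≠ 0) →
        0 ≤ (∑ j : Fin 3 → Fin m,
          Real.log ((⟪(τ[fun p : Fin N × Fin 3 =>
            (Pi.single i (toUnitTorus L (latticeVec (L / m) (fun k => ((j k : ℕ) : ℤ)))) :
              Fin N → UnitAddTorus (Fin 3)) p.1 p.2] f : L2T N), f⟫_ℂ).re) *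
            Real.cos (2 * Real.pi * (∑ k, ((q k : ℕ) : ℝ) * ((j k : ℕ) : ℝ)) / m)) / (m : ℝ) ^ 3) :
    ∃ δ : ℝ≥0∞, 0 < δ ∧ ∀ Ψ : PeriodicTrialState N L,
      periodicEnergy v Ψ ≤ periodicGroundStateEnergy v N L + δ → ∀ (i : Fin N) (q : Fin 3 → Fin m),
        (∃ k, (q k : ℕ) ≠ 0) →
        -ε ≤ (∑ j : Fin 3 → Fin m,
          Real.log ((∫ X in cellN N L, conj (Ψ.ψ (Function.update X i
            (X i + latticeVec (L / m) (fun k => ((j k : ℕ) : ℤ))))) * Ψ.ψ X).re) *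
            Real.cos (2 * Real.pi * (∑ k, ((q k : ℕ) : ℝ) * ((j k : ℕ) : ℝ)) / m)) / (m : ℝ) ^ 3 := by
  choose δf hδf0 hδf using fun (i : Fin N) (q : Fin 3 → Fin m) => exists_slack_one hv hL hE m hε hP hS i q
  refine ⟨Finset.univ.inf fun p : Fin N × (Fin 3 → Fin m) => δf p.1 p.2,
    (Finset.lt_inf_iff ENNReal.zero_lt_top).2 fun p _ => hδf0 p.1 p.2, fun Ψ hΨ i q hq => ?_⟩
  exact hδf i q Ψ (hΨ.trans (add_le_add le_rfl
    (Finset.inf_le (f := fun p : Fin N × (Fin 3 → Fin m) => δf p.1 p.2) (Finset.mem_univ (i, q))))) hq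

end GridLevySignReduction

/-- **Registered stub `stub_gridLevySign_of_groundStates`** (line `registered`, crux stmt-AtomisticToContinuum-9114;
the soft reduction). Ground-state coherence positivity and the exact ground-state sign statement imply the crux's
sign conjunct in its near-minimiser form (`∀ ε ∃ δ`): fix `v`; take `η, ρ₀` from the hypotheses and `ρ₁` from Ruelle
finiteness (`exists_eventually_periodicGroundStateEnergy_lt_top`); at a large `N` apply
`GridLevySignReduction.exists_slack_all` (contradiction + `CoherencePosHC.exists_groundState_limit` + the dictionary
`CoherencePosL2.inner_translate_formEmbed_trialState` + continuity of the amplitude and of `Real.log` at the positive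
limits + finiteness of the grid). Stated `let`-free (the skeleton's `let L := sideLength ρ N`, `let m := ⌊L/η⌋₊`,
`let G := …` substituted: the stub registry keeps one-line signatures cut at the first `:=`); the `let` form is the
definitionally equal corollary `stub_gridLevySign_of_groundStates_letForm` below. [cite: ReedSimonIV1978, Thm XIII.64] -/
theorem stub_gridLevySign_of_groundStates :
    (∀ v : ℝ → ℝ≥0∞, IsRepulsiveFiniteRange v →
      ∃ ρ₀ : ℝ, 0 < ρ₀ ∧ ∀ ρ : ℝ, 0 < ρ → ρ < ρ₀ → ∀ᶠ N : ℕ in atTop,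
        ∀ f : Lp ℂ 2 (volume : Measure (UnitAddTorus (Fin N × Fin 3))),
          f ∈ maxFormGroundStates v N (sideLength ρ N) → ‖f‖ = 1 →
            ∀ (i : Fin N) (u : UnitAddTorus (Fin 3)),
              0 < (⟪(Lp.compMeasurePreservingₗᵢ ℂ
                  (fun t : UnitAddTorus (Fin N × Fin 3) => t + fun p : Fin N × Fin 3 =>
                    (Pi.single i u : Fin N → UnitAddTorus (Fin 3)) p.1 p.2)
                  (measurePreserving_add_right volume _) f), f⟫_ℂ).re) →
    (∀ v : ℝ → ℝ≥0∞, IsRepulsiveFiniteRange v → ∃ η : ℝ, 0 < η ∧ ∃ ρ₀ : ℝ, 0 < ρ₀ ∧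
      ∀ ρ : ℝ, 0 < ρ → ρ < ρ₀ → ∀ᶠ N : ℕ in atTop,
        ∀ f : Lp ℂ 2 (volume : Measure (UnitAddTorus (Fin N × Fin 3))),
          f ∈ maxFormGroundStates v N (sideLength ρ N) → ‖f‖ = 1 → ∀ i : Fin N,
            (∀ r : EuclideanSpace ℝ (Fin 3), 0 < (⟪(Lp.compMeasurePreservingₗᵢ ℂ
                (fun t : UnitAddTorus (Fin N × Fin 3) => t + fun p : Fin N × Fin 3 =>
                  (Pi.single i (toUnitTorus (sideLength ρ N) r) : Fin N → UnitAddTorus (Fin 3)) p.1 p.2)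
                (measurePreserving_add_right volume _) f), f⟫_ℂ).re) →
            ∀ q : Fin 3 → Fin ⌊sideLength ρ N / η⌋₊, (∃ k, (q k : ℕ) ≠ 0) →
              0 ≤ (∑ j : Fin 3 → Fin ⌊sideLength ρ N / η⌋₊,
                Real.log ((⟪(Lp.compMeasurePreservingₗᵢ ℂ
                  (fun t : UnitAddTorus (Fin N × Fin 3) => t + fun p : Fin N × Fin 3 =>
                    (Pi.single i (toUnitTorus (sideLength ρ N)
                      (latticeVec (sideLength ρ N / ⌊sideLength ρ N / η⌋₊) (fun k => ((j k : ℕ) : ℤ)))) :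
                      Fin N → UnitAddTorus (Fin 3)) p.1 p.2)
                  (measurePreserving_add_right volume _) f), f⟫_ℂ).re) *
                  Real.cos (2 * Real.pi * (∑ k, ((q k : ℕ) : ℝ) * ((j k : ℕ) : ℝ)) / ⌊sideLength ρ N / η⌋₊)) /
                ((⌊sideLength ρ N / η⌋₊ : ℕ) : ℝ) ^ 3) →
    ∀ v : ℝ → ℝ≥0∞, IsRepulsiveFiniteRange v → ∃ η : ℝ, 0 < η ∧ ∃ ρ₀ : ℝ, 0 < ρ₀ ∧
      ∀ ρ : ℝ, 0 < ρ → ρ < ρ₀ → ∀ᶠ N : ℕ in atTop, ∀ ε : ℝ, 0 < ε → ∃ δ : ℝ≥0∞, 0 < δ ∧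
        ∀ Ψ : PeriodicTrialState N (sideLength ρ N),
          periodicEnergy v Ψ ≤ periodicGroundStateEnergy v N (sideLength ρ N) + δ →
          ∀ i : Fin N, ∀ q : Fin 3 → Fin ⌊sideLength ρ N / η⌋₊, (∃ k, (q k : ℕ) ≠ 0) →
            -ε ≤ (∑ j : Fin 3 → Fin ⌊sideLength ρ N / η⌋₊,
              Real.log ((∫ X in cellN N (sideLength ρ N), conj (Ψ.ψ (Function.update X i
                (X i + latticeVec (sideLength ρ N / ⌊sideLength ρ N / η⌋₊) (fun k => ((j k : ℕ) : ℤ))))) *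
                  Ψ.ψ X).re) *
                Real.cos (2 * Real.pi * (∑ k, ((q k : ℕ) : ℝ) * ((j k : ℕ) : ℝ)) / ⌊sideLength ρ N / η⌋₊)) /
              ((⌊sideLength ρ N / η⌋₊ : ℕ) : ℝ) ^ 3 := by
  intro hPos hSign v hv
  obtain ⟨η, hη, ρS, hρS, hS⟩ := hSign v hv
  obtain ⟨ρP, hρP, hP⟩ := hPos v hv
  obtain ⟨ρF, hρF, hfin⟩ :=
    Literature.Barriers.AtomisticToContinuum.BoseGas.exists_eventually_periodicGroundStateEnergy_lt_top hv
  refine ⟨η, hη, min ρS (min ρP ρF), lt_min hρS (lt_min hρP hρF), fun ρ hρ hρlt => ?_⟩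
  have hρS' : ρ < ρS := hρlt.trans_le (min_le_left _ _)
  have hρP' : ρ < ρP := hρlt.trans_le ((min_le_right _ _).trans (min_le_left _ _))
  have hρF' : ρ < ρF := hρlt.trans_le ((min_le_right _ _).trans (min_le_right _ _))
  filter_upwards [hS ρ hρ hρS', hP ρ hρ hρP', hfin ρ hρ hρF',
    (tendsto_sideLength_atTop hρ).eventually_gt_atTop 0] with N hSN hPN hEN hL
  intro ε hε
  exact GridLevySignReduction.exists_slack_all hv hL hEN.ne ⌊sideLength ρ N / η⌋₊ hε hPN hSN

/-- **The registered stub in the `let` form of the skeleton** (verbatim the skeleton's statement of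
`stub_gridLevySign_of_groundStates`, with its `let L`, `let m`, `let G` binders): definitionally equal to the `let`-free
form above (the term is `stub_gridLevySign_of_groundStates` itself). [folklore] -/
theorem stub_gridLevySign_of_groundStates_letForm :
    (∀ v : ℝ → ℝ≥0∞, IsRepulsiveFiniteRange v →
      ∃ ρ₀ : ℝ, 0 < ρ₀ ∧ ∀ ρ : ℝ, 0 < ρ → ρ < ρ₀ → ∀ᶠ N : ℕ in atTop,
        ∀ f : Lp ℂ 2 (volume : Measure (UnitAddTorus (Fin N × Fin 3))),
          f ∈ maxFormGroundStates v N (sideLength ρ N) → ‖f‖ = 1 →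
            ∀ (i : Fin N) (u : UnitAddTorus (Fin 3)),
              0 < (⟪(Lp.compMeasurePreservingₗᵢ ℂ
                  (fun t : UnitAddTorus (Fin N × Fin 3) => t + fun p : Fin N × Fin 3 =>
                    (Pi.single i u : Fin N → UnitAddTorus (Fin 3)) p.1 p.2)
                  (measurePreserving_add_right volume _) f), f⟫_ℂ).re) →
    (∀ v : ℝ → ℝ≥0∞, IsRepulsiveFiniteRange v → ∃ η : ℝ, 0 < η ∧ ∃ ρ₀ : ℝ, 0 < ρ₀ ∧
      ∀ ρ : ℝ, 0 < ρ → ρ < ρ₀ → ∀ᶠ N : ℕ in atTop,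
        ∀ f : Lp ℂ 2 (volume : Measure (UnitAddTorus (Fin N × Fin 3))),
          f ∈ maxFormGroundStates v N (sideLength ρ N) → ‖f‖ = 1 → ∀ i : Fin N,
            let L : ℝ := sideLength ρ N
            let m : ℕ := ⌊L / η⌋₊
            let G : EuclideanSpace ℝ (Fin 3) → ℝ := fun r =>
              (⟪(Lp.compMeasurePreservingₗᵢ ℂ
                  (fun t : UnitAddTorus (Fin N × Fin 3) => t + fun p : Fin N × Fin 3 =>
                    (Pi.single i (toUnitTorus L r) : Fin N → UnitAddTorus (Fin 3)) p.1 p.2)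
                  (measurePreserving_add_right volume _) f), f⟫_ℂ).re
            (∀ r, 0 < G r) → ∀ q : Fin 3 → Fin m, (∃ k, (q k : ℕ) ≠ 0) →
              0 ≤ (∑ j : Fin 3 → Fin m,
                Real.log (G (latticeVec (L / m) (fun k => ((j k : ℕ) : ℤ)))) *
                  Real.cos (2 * Real.pi * (∑ k, ((q k : ℕ) : ℝ) * ((j k : ℕ) : ℝ)) / m)) /
                (m : ℝ) ^ 3) →
    ∀ v : ℝ → ℝ≥0∞, IsRepulsiveFiniteRange v → ∃ η : ℝ, 0 < η ∧ ∃ ρ₀ : ℝ, 0 < ρ₀ ∧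
      ∀ ρ : ℝ, 0 < ρ → ρ < ρ₀ → ∀ᶠ N : ℕ in atTop, ∀ ε : ℝ, 0 < ε → ∃ δ : ℝ≥0∞, 0 < δ ∧
        ∀ Ψ : PeriodicTrialState N (sideLength ρ N),
          periodicEnergy v Ψ ≤ periodicGroundStateEnergy v N (sideLength ρ N) + δ →
          ∀ i : Fin N,
            let L : ℝ := sideLength ρ N
            let m : ℕ := ⌊L / η⌋₊
            let G : EuclideanSpace ℝ (Fin 3) → ℝ := fun r =>
              (∫ X in cellN N L, conj (Ψ.ψ (Function.update X i (X i + r))) * Ψ.ψ X).re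
            ∀ q : Fin 3 → Fin m, (∃ k, (q k : ℕ) ≠ 0) →
              -ε ≤ (∑ j : Fin 3 → Fin m,
                Real.log (G (latticeVec (L / m) (fun k => ((j k : ℕ) : ℤ)))) *
                  Real.cos (2 * Real.pi * (∑ k, ((q k : ℕ) : ℝ) * ((j k : ℕ) : ℝ)) / m)) /
                (m : ℝ) ^ 3 :=
  stub_gridLevySign_of_groundStates

end Summit.AtomisticToContinuum.BoseEinsteinCondensation.Theorems

end
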